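import Mathlib
import Literature.NumberTheory.LFunctions.KlurmanMangerelTeravainenShortAPs
import Summits.QuantumAdvantage.QuantumAdvantage.Theorems.MobiusLadderDigitPolyUniformityKMTDiscretise
import Summits.QuantumAdvantage.QuantumAdvantage.Theorems.MobiusLadderDigitPolyUniformityKMTWindowAverageAP
import Summits.QuantumAdvantage.QuantumAdvantage.Theorems.MobiusLadderDigitPolyUniformityKMTMainTerm
import Summits.QuantumAdvantage.QuantumAdvantage.Theorems.MobiusLadderDigitPolyUniformityKMTCauchySchwarz
import Literature.NumberTheory.Sieve.ParityBarrier
import Literature.NumberTheory.LFunctions.MatomakiRadziwillTaoMajorArc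
import HarnessLib

/-!
# Crux `DigitPolyUniformity` (stmt-QuantumAdvantage-1392), line `Sketch` — cycle 7 (seat c6):
# odd residue classes at one dyadic scale, from Klurman–Mangerel–Teräväinen

The per-scale step of the KLURMAN–MANGEREL–TERÄVÄINEN CLASS (`Cruxes/DigitPolyUniformity/Lines/SketchLAR.lean`, §Cycle 7;
registered lead stub `kmt_oddAP_scale_le`).  Fix a modulus `q = 2^k` (`k ≥ 1`), a block length `H = 2^h` and a dyadic
scale `X = 2^i ≥ H`.  The blocks `[Hy, Hy + H)` with `2^{i−h} ≤ y < 2^{i+1−h}` tile `[X, 2X)`.  For each block and each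
odd residue `a`, the block sum of `λ` over the class of `a` is within `2(T/q + 1)` of each of the `T = 2^{h−τ}` window
sums `Σ_{m<n≤m+H, n≡a} λ(n)`, `m ∈ [Hy, Hy+T)` (`stub_kmt_window_average_AP`); the windows of distinct blocks are
disjoint subsets of `[X, 2X)`; by Cauchy–Schwarz (`stub_kmt_cauchySchwarz`) the double sum `Σ_{m∈[X,2X)} Σ_{a odd} |W_m(a)|`
is at most `√(X·2^k)·√(2·MS + 2·MT²)`, where the mean square `MS` of `W_m(a)` minus the Klurman–Mangerel–Teräväinen main
term is `≤ C₀ ε₁ φ(q) X (H/q)²` by the NAMED FACT `KMT2023_corollary17_liouville_twoPower` (Corollary 1.7 / Theorem 1.6 of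
Klurman–Mangerel–Teräväinen 2023 for `f = λ`, `q = 2^k`; the integral is a sum by `stub_kmt_discretise`), and the main
term is `≤ K X e^{−c₂√log X}·H/(Xφ(q))` by `stub_kmt_mainTerm` (the tree's PROVED Green/Montgomery–Vaughan bound for `λ`
twisted by characters to 2-power moduli — no exceptional zero).  Net:
`Σ_y Σ_{a odd} |S(y,a)| ≤ 2^i (2^τ (√C₀ √ε₁ + 3Kp e^{−c₂√(i log 2)}) + 2/2^τ + 2·2^k/2^h)`.
This file is CONDITIONAL on the KMT named fact (hypothesis `hKMT`), and on nothing else.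
-/

noncomputable section

namespace Summit.QuantumAdvantage.DigitPolyUniformity.SketchLAR.KMT

open Finset MeasureTheory
open Literature.NumberTheory.LFunctions

namespace Scale

/-- For `k ≥ 1`, the residues `a < 2^k` coprime to `2^k` are the odd ones. [folklore] -/
theorem filter_coprime_eq_filter_odd {k : ℕ} (hk : 1 ≤ k) :
    (range (2 ^ k)).filter (fun a => Nat.Coprime a (2 ^ k)) = (range (2 ^ k)).filter (fun a => Odd a) := by
  refine Finset.filter_congr fun a _ => ?_
  rw [Nat.coprime_pow_right_iff hk, Nat.coprime_two_right]

/-- Windows to the right of distinct blocks are disjoint subsets of `[X, 2X)`: for `G ≥ 0`, `T ≤ H`,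
`X ≤ H·Y₀` and `H·Y₁ ≤ 2X`, `Σ_{Y₀ ≤ y < Y₁} Σ_{m ∈ [Hy, Hy+T)} G(m) ≤ Σ_{m ∈ [X, 2X)} G(m)`. [folklore] -/
theorem sum_windows_le (G : ℕ → ℝ) (hG : ∀ m, 0 ≤ G m) (H T Y₀ Y₁ X : ℕ) (hT : T ≤ H)
    (hlo : X ≤ H * Y₀) (hhi : H * Y₁ ≤ 2 * X) :
    ∑ y ∈ Ico Y₀ Y₁, ∑ m ∈ Ico (H * y) (H * y + T), G m ≤ ∑ m ∈ Ico X (2 * X), G m := by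
  have hdisj : Set.PairwiseDisjoint (↑(Ico Y₀ Y₁) : Set ℕ) (fun y => Ico (H * y) (H * y + T)) := by
    intro y _ y' _ hne
    simp only [Function.onFun]
    rw [Finset.disjoint_left]
    intro m hm hm'
    rw [Finset.mem_Ico] at hm hm'
    rcases Nat.lt_or_gt_of_ne hne with hlt | hlt
    · have : H * y + H ≤ H * y' := by rw [← Nat.mul_succ]; exact Nat.mul_le_mul_left _ hlt
      omega
    · have : H * y' + H ≤ H * y := by rw [← Nat.mul_succ]; exact Nat.mul_le_mul_left _ hlt
      omega
  rw [← Finset.sum_biUnion hdisj]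
  refine Finset.sum_le_sum_of_subset_of_nonneg ?_ (fun m _ _ => hG m)
  intro m hm
  rw [Finset.mem_biUnion] at hm
  obtain ⟨y, hy, hm⟩ := hm
  rw [Finset.mem_Ico] at hy hm ⊢
  have h1 : H * Y₀ ≤ H * y := Nat.mul_le_mul_left _ hy.1
  have h2 : H * y + H ≤ H * Y₁ := by rw [← Nat.mul_succ]; exact Nat.mul_le_mul_left _ hy.2
  omega

/-- The real algebra of the Cauchy–Schwarz step: if `MS ≤ C₀ε₁·X·H²/(2q)`, `MT2 ≤ 4K²·X·H²·e²/q` and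
`S ≤ √(Xq)·√(2MS + 2MT2)` then `S ≤ X·H·(√C₀·√ε₁ + 3K·e)`. [folklore] -/
theorem cs_numeric {X H q C₀ ε₁ K e MS MT2 S : ℝ} (hX : 0 < X) (hH : 0 < H) (hq : 0 < q) (hC₀ : 0 ≤ C₀)
    (hε₁ : 0 ≤ ε₁) (hK : 0 ≤ K) (he : 0 ≤ e)
    (hMS : MS ≤ C₀ * ε₁ * X * H ^ 2 / (2 * q)) (hMT2 : MT2 ≤ 4 * K ^ 2 * X * H ^ 2 * e ^ 2 / q)
    (hS : S ≤ Real.sqrt (X * q) * Real.sqrt (2 * MS + 2 * MT2)) :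
    S ≤ X * H * (Real.sqrt C₀ * Real.sqrt ε₁ + 3 * K * e) := by
  have h1 : 2 * MS + 2 * MT2 ≤ X * H ^ 2 / q * (C₀ * ε₁ + 8 * K ^ 2 * e ^ 2) := by
    have : X * H ^ 2 / q * (C₀ * ε₁ + 8 * K ^ 2 * e ^ 2) =
        2 * (C₀ * ε₁ * X * H ^ 2 / (2 * q)) + 2 * (4 * K ^ 2 * X * H ^ 2 * e ^ 2 / q) := by
      field_simp; ring
    rw [this]; linarith
  have h2 : Real.sqrt (X * q) * Real.sqrt (2 * MS + 2 * MT2) ≤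
      Real.sqrt (X * q) * Real.sqrt (X * H ^ 2 / q * (C₀ * ε₁ + 8 * K ^ 2 * e ^ 2)) :=
    mul_le_mul_of_nonneg_left (Real.sqrt_le_sqrt h1) (Real.sqrt_nonneg _)
  have h3 : Real.sqrt (X * q) * Real.sqrt (X * H ^ 2 / q * (C₀ * ε₁ + 8 * K ^ 2 * e ^ 2)) =
      X * H * Real.sqrt (C₀ * ε₁ + 8 * K ^ 2 * e ^ 2) := by
    rw [← Real.sqrt_mul (by positivity)]
    have : X * q * (X * H ^ 2 / q * (C₀ * ε₁ + 8 * K ^ 2 * e ^ 2)) =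
        (X * H) ^ 2 * (C₀ * ε₁ + 8 * K ^ 2 * e ^ 2) := by
      field_simp
    rw [this, Real.sqrt_mul (by positivity), Real.sqrt_sq (by positivity)]
  have h4 : Real.sqrt (C₀ * ε₁ + 8 * K ^ 2 * e ^ 2) ≤ Real.sqrt C₀ * Real.sqrt ε₁ + 3 * K * e := by
    calc Real.sqrt (C₀ * ε₁ + 8 * K ^ 2 * e ^ 2)
        ≤ Real.sqrt (C₀ * ε₁) + Real.sqrt (8 * K ^ 2 * e ^ 2) :=
          MRT2015.sqrt_add_le_sqrt_add_sqrt (by positivity) (by positivity)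
      _ ≤ Real.sqrt C₀ * Real.sqrt ε₁ + 3 * K * e := by
          rw [Real.sqrt_mul hC₀]
          gcongr
          rw [Real.sqrt_le_left (by positivity)]
          nlinarith [sq_nonneg (K * e), mul_nonneg hK he]
  calc S ≤ _ := hS
    _ ≤ _ := h2
    _ = _ := h3
    _ ≤ X * H * (Real.sqrt C₀ * Real.sqrt ε₁ + 3 * K * e) :=
        mul_le_mul_of_nonneg_left h4 (by positivity)

end Scale

open Scale

/-- **Odd residue classes at one dyadic scale (lead; CONDITIONAL on the KMT named fact).** Constants `A, c₂, K'`
such that for admissible parameters (`0 < ε₁ ≤ 1`, `1 ≤ k`, `k + 4 ≤ h`, `τ ≤ h ≤ i`, window `(h−k) log 2 ≥ ε₁^{−200}`,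
typicality `(h−k)ε₁² log 2 ≥ log 541`, `k ≤ ε₁^{200} i`, main term `k² log 2 ≤ c₂² i`) the odd-residue block sums of
`λ` modulo `2^k` over the blocks of length `2^h` inside `[2^i, 2^{i+1})` total at most
`2^i (2^τ (A√ε₁ + K' e^{−c₂√(i log 2)}) + 2/2^τ + 2·2^k/2^h)`: windows to the right of each block
(`stub_kmt_window_average_AP`, `T = 2^{h−τ}`), Cauchy–Schwarz (`stub_kmt_cauchySchwarz`), the mean square from the
KMT named fact (`stub_kmt_discretise`), the main term from `stub_kmt_mainTerm`.
[cite: KlurmanMangerelTeravainen2023ShortAPs, Corollary 1.7 and Theorem 1.6] -/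
theorem kmt_oddAP_scale_le (hKMT : KMT2023_corollary17_liouville_twoPower) :
    ∃ A : ℝ, 0 ≤ A ∧ ∃ c₂ : ℝ, 0 < c₂ ∧ ∃ K' : ℝ, 0 ≤ K' ∧
      ∀ (ε₁ : ℝ) (τ i k h : ℕ), 0 < ε₁ → ε₁ ≤ 1 → 1 ≤ k → k + 4 ≤ h → τ ≤ h → h ≤ i →
        ε₁ ^ (-(200 : ℝ)) ≤ ((h - k : ℕ) : ℝ) * Real.log 2 →
        Real.log 541 ≤ ((h - k : ℕ) : ℝ) * ε₁ ^ 2 * Real.log 2 →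
        (k : ℝ) ≤ ε₁ ^ (200 : ℕ) * i →
        (k : ℝ) ^ 2 * Real.log 2 ≤ c₂ ^ 2 * i →
        ∑ y ∈ Ico (2 ^ (i - h)) (2 ^ (i + 1 - h)), ∑ a ∈ (range (2 ^ k)).filter (fun a => Odd a),
          |∑ N ∈ (Ico (2 ^ h * y) (2 ^ h * y + 2 ^ h)).filter (fun N => N % 2 ^ k = a),
            ((ArithmeticFunction.liouville N : ℤ) : ℝ)| ≤
          (2 : ℝ) ^ i * (2 ^ τ * (A * Real.sqrt ε₁ + K' * Real.exp (-(c₂ * Real.sqrt (i * Real.log 2)))) +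
            2 / 2 ^ τ + 2 * 2 ^ k / 2 ^ h) := by
  obtain ⟨C₀, hC₀, hK⟩ := hKMT
  obtain ⟨c₂, hc₂, K, hM⟩ := stub_kmt_mainTerm
  set Kp : ℝ := max K 0 with hKpdef
  have hKp0 : 0 ≤ Kp := le_max_right _ _
  have hKKp : K ≤ Kp := le_max_left _ _
  refine ⟨Real.sqrt C₀, Real.sqrt_nonneg _, c₂, hc₂, 3 * Kp, by positivity, ?_⟩
  intro ε₁ τ i k h hε₁ hε₁1 hk1 hkh hτh hhi hwin htyp hkε hkc
  -- the natural parameters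
  set X : ℕ := 2 ^ i with hXdef
  set H : ℕ := 2 ^ h with hHdef
  set T : ℕ := 2 ^ (h - τ) with hTdef
  have hlog2 : 0 < Real.log 2 := Real.log_pos one_lt_two
  have hXpos : 0 < X := Nat.two_pow_pos i
  have hX1 : 1 ≤ X := hXpos
  have hHX : H ≤ X := Nat.pow_le_pow_right (by norm_num) hhi
  have hTH : T ≤ H := Nat.pow_le_pow_right (by norm_num) (Nat.sub_le h τ)
  have hTpos : 0 < T := Nat.two_pow_pos _
  have hHk : 2 ^ h = 2 ^ (h - k) * 2 ^ k := by rw [← pow_add]; congr 1; omega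
  have hHτ : 2 ^ h = 2 ^ τ * 2 ^ (h - τ) := by rw [← pow_add]; congr 1; omega
  have h16 : 16 ≤ 2 ^ (h - k) := by
    calc (16 : ℕ) = 2 ^ 4 := by norm_num
      _ ≤ 2 ^ (h - k) := Nat.pow_le_pow_right (by norm_num) (by omega)
  -- real casts
  have hXR : ((X : ℕ) : ℝ) = (2 : ℝ) ^ i := by rw [hXdef]; push_cast; ring
  have hHR : ((H : ℕ) : ℝ) = (2 : ℝ) ^ h := by rw [hHdef]; push_cast; ring
  have hTR : ((T : ℕ) : ℝ) = (2 : ℝ) ^ h / 2 ^ τ := by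
    rw [hTdef]; push_cast
    rw [eq_div_iff (by positivity), show ((2 : ℝ) ^ (h - τ)) * 2 ^ τ = 2 ^ (h - τ + τ) by rw [pow_add],
      Nat.sub_add_cancel hτh]
  have hqR : ((2 ^ k : ℕ) : ℝ) = (2 : ℝ) ^ k := by push_cast; ring
  have hXRpos : (0 : ℝ) < (X : ℝ) := by exact_mod_cast hXpos
  have hHRpos : (0 : ℝ) < (H : ℝ) := by rw [hHR]; positivity
  have hqRpos : (0 : ℝ) < (2 : ℝ) ^ k := by positivity
  have hφ : (Nat.totient (2 ^ k) : ℝ) = (2 : ℝ) ^ k / 2 := by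
    rw [Nat.totient_prime_pow Nat.prime_two hk1, show (2 - 1 : ℕ) = 1 from rfl, mul_one]
    push_cast
    rw [eq_div_iff two_ne_zero, ← pow_succ, Nat.sub_add_cancel hk1]
  have hφpos : (0 : ℝ) < (Nat.totient (2 ^ k) : ℝ) := by rw [hφ]; positivity
  have hHq : ((H : ℕ) : ℝ) / 2 ^ k = (2 : ℝ) ^ (h - k) := by
    rw [hHR, div_eq_iff (by positivity), ← pow_add, Nat.sub_add_cancel (by omega)]
  -- the hypotheses of the KMT named fact at this scale
  have h10H : (10 : ℝ) ≤ (H : ℝ) := by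
    rw [hHR]
    have : (2 : ℝ) ^ 5 ≤ 2 ^ h := pow_le_pow_right₀ (by norm_num) (by omega)
    linarith [show (2 : ℝ) ^ 5 = 32 by norm_num]
  have hHXR : ((H : ℕ) : ℝ) ≤ (X : ℝ) := by exact_mod_cast hHX
  have h1q : (1 : ℝ) ≤ (2 : ℝ) ^ k := one_le_pow₀ (by norm_num)
  have h10q : 10 * (2 : ℝ) ^ k ≤ (H : ℝ) := by
    rw [hHR]
    have : (16 : ℝ) * 2 ^ k ≤ 2 ^ h := by
      have h16R : (16 : ℝ) ≤ 2 ^ (h - k) := by exact_mod_cast h16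
      calc (16 : ℝ) * 2 ^ k ≤ 2 ^ (h - k) * 2 ^ k := by gcongr
        _ = 2 ^ h := by rw [← pow_add, Nat.sub_add_cancel (by omega)]
    nlinarith [hqRpos]
  have hlogHq : Real.log ((H : ℝ) / 2 ^ k) = ((h - k : ℕ) : ℝ) * Real.log 2 := by
    rw [hHq, Real.log_pow]
  have hlogcond : Real.log ((H : ℝ) / 2 ^ k) ^ (-(1 / 200 : ℝ)) ≤ ε₁ := by
    rw [hlogHq]
    have hpos : (0 : ℝ) < ε₁ ^ (-(200 : ℝ)) := Real.rpow_pos_of_pos hε₁ _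
    calc (((h - k : ℕ) : ℝ) * Real.log 2) ^ (-(1 / 200 : ℝ))
        ≤ (ε₁ ^ (-(200 : ℝ))) ^ (-(1 / 200 : ℝ)) :=
          Real.rpow_le_rpow_of_nonpos hpos hwin (by norm_num)
      _ = ε₁ := by
          rw [← Real.rpow_mul hε₁.le]; norm_num
  have hQX : (2 : ℝ) ^ k ≤ (X : ℝ) ^ (ε₁ ^ 200) := by
    rw [hXR]
    calc (2 : ℝ) ^ k = (2 : ℝ) ^ ((k : ℕ) : ℝ) := (Real.rpow_natCast 2 k).symm
      _ ≤ (2 : ℝ) ^ ((i : ℝ) * ε₁ ^ 200) := by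
          refine Real.rpow_le_rpow_of_exponent_le (by norm_num) ?_
          rw [mul_comm]; exact hkε
      _ = ((2 : ℝ) ^ i) ^ (ε₁ ^ 200) := by
          rw [Real.rpow_mul (by norm_num), Real.rpow_natCast]
  have htypcond : (541 : ℝ) ≤ ((H : ℝ) / 2 ^ k) ^ (ε₁ ^ 2) := by
    rw [hHq, Real.rpow_def_of_pos (by positivity), Real.log_pow]
    calc (541 : ℝ) = Real.exp (Real.log 541) := (Real.exp_log (by norm_num)).symm
      _ ≤ Real.exp (((h - k : ℕ) : ℝ) * Real.log 2 * ε₁ ^ 2) := by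
          rw [Real.exp_le_exp]
          calc Real.log 541 ≤ ((h - k : ℕ) : ℝ) * ε₁ ^ 2 * Real.log 2 := htyp
            _ = _ := by ring
  have hqQ : (2 : ℝ) ^ k ≤ (2 : ℝ) ^ k := le_rfl
  obtain ⟨χ₁, hχ⟩ := hK ε₁ (X : ℝ) (H : ℝ) ((2 : ℝ) ^ k) hε₁ hε₁1 h10H hHXR h1q h10q hlogcond hQX htypcond
    k hqQ
  -- the main term
  have hmaincond : (2 : ℝ) ^ k ≤ Real.exp (c₂ * Real.sqrt (Real.log X)) := by
    rw [hXR, Real.log_pow]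
    have hklog : Real.log ((2 : ℝ) ^ k) = k * Real.log 2 := Real.log_pow _ _
    rw [← Real.exp_log (by positivity : (0 : ℝ) < 2 ^ k), Real.exp_le_exp, hklog]
    have hk0 : (0 : ℝ) ≤ k * Real.log 2 := by positivity
    have hsq : ((k : ℝ) * Real.log 2) ^ 2 ≤ c₂ ^ 2 * (i * Real.log 2) := by
      have := mul_le_mul_of_nonneg_right hkc hlog2.le
      calc ((k : ℝ) * Real.log 2) ^ 2 = (k : ℝ) ^ 2 * Real.log 2 * Real.log 2 := by ring
        _ ≤ c₂ ^ 2 * i * Real.log 2 := this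
        _ = c₂ ^ 2 * (i * Real.log 2) := by ring
    calc (k : ℝ) * Real.log 2 = Real.sqrt (((k : ℝ) * Real.log 2) ^ 2) := (Real.sqrt_sq hk0).symm
      _ ≤ Real.sqrt (c₂ ^ 2 * (i * Real.log 2)) := Real.sqrt_le_sqrt hsq
      _ = c₂ * Real.sqrt (i * Real.log 2) := by
          rw [Real.sqrt_mul (sq_nonneg _), Real.sqrt_sq hc₂.le]
  obtain ⟨hχ1, hL⟩ := hM k X hX1 hmaincond χ₁
  set e : ℝ := Real.exp (-(c₂ * Real.sqrt (Real.log X))) with hedef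
  have he0 : 0 ≤ e := (Real.exp_pos _).le
  have heX : e = Real.exp (-(c₂ * Real.sqrt (i * Real.log 2))) := by
    rw [hedef, hXR, Real.log_pow]
  -- notation for the sums (kept folded)
  obtain ⟨Lsum, hLsum⟩ : ∃ Lsum : ℝ,
      Lsum = ∑ n ∈ Icc X (2 * X), (ArithmeticFunction.liouville n : ℝ) * χ₁ (n : ZMod (2 ^ k)) := ⟨_, rfl⟩
  obtain ⟨MT, hMTdef⟩ : ∃ MT : ℕ → ℝ, ∀ a, MT a =
      χ₁ (a : ZMod (2 ^ k)) / (Nat.totient (2 ^ k) : ℝ) * ((H : ℝ) / X) * Lsum := ⟨_, fun _ => rfl⟩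
  obtain ⟨W, hWdef⟩ : ∃ W : ℕ → ℕ → ℝ, ∀ m a, W m a =
      ∑ n ∈ (Ioc m (m + H)).filter (fun n => n % 2 ^ k = a), (ArithmeticFunction.liouville n : ℝ) :=
    ⟨_, fun _ _ => rfl⟩
  obtain ⟨Todd, hTodd⟩ : ∃ Todd : Finset ℕ, Todd = (range (2 ^ k)).filter (fun a => Odd a) := ⟨_, rfl⟩
  have hTodd_card : (Todd.card : ℝ) ≤ (2 : ℝ) ^ k := by
    have : Todd.card ≤ 2 ^ k := by
      rw [hTodd]; exact (Finset.card_filter_le _ _).trans (Finset.card_range _).le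
    exact_mod_cast this
  -- (1) the mean square, from the named fact and the discretisation
  have hMS : ∑ m ∈ Ico X (2 * X), ∑ a ∈ Todd, (W m a - MT a) ^ 2 ≤
      C₀ * ε₁ * (Nat.totient (2 ^ k) : ℝ) * X * ((H : ℝ) / 2 ^ k) ^ 2 := by
    have hdisc := stub_kmt_discretise (fun m => ∑ a ∈ Todd, (W m a - MT a) ^ 2) X (2 * X) (by omega)
    have hcast2 : ((2 * X : ℕ) : ℝ) = 2 * (X : ℝ) := by push_cast; ring
    rw [hcast2] at hdisc
    rw [← hdisc]
    refine le_of_eq_of_le (intervalIntegral.integral_congr fun x hx => ?_) hχ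
    have hx0 : 0 ≤ x := by
      rw [Set.uIcc_of_le (by linarith)] at hx
      exact hXRpos.le.trans hx.1
    rw [filter_coprime_eq_filter_odd hk1, ← hTodd, Nat.floor_add_natCast hx0, Nat.ceil_natCast,
      show (2 : ℝ) * (X : ℝ) = ((2 * X : ℕ) : ℝ) by push_cast; ring, Nat.floor_natCast, ← hLsum]
    refine Finset.sum_congr rfl fun a _ => ?_
    rw [hWdef, hMTdef]
  -- (2) the main term is small
  have hLle : |Lsum| ≤ Kp * X * e := by
    rw [hLsum]
    refine hL.trans ?_
    gcongr
  have hMTa : ∀ a, |MT a| ≤ 2 * Kp * H * e / 2 ^ k := by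
    intro a
    rw [hMTdef, abs_mul, abs_mul, abs_div, abs_of_pos hφpos, abs_div, abs_of_pos hHRpos, abs_of_pos hXRpos, hφ]
    calc |χ₁ (a : ZMod (2 ^ k))| / (2 ^ k / 2) * ((H : ℝ) / X) * |Lsum|
        ≤ 1 / (2 ^ k / 2) * ((H : ℝ) / X) * (Kp * X * e) := by
          gcongr
          exact hχ1 _
      _ = 2 * Kp * H * e / 2 ^ k := by field_simp
  have hMT2 : ∑ m ∈ Ico X (2 * X), ∑ a ∈ Todd, (MT a) ^ 2 ≤
      4 * Kp ^ 2 * X * (H : ℝ) ^ 2 * e ^ 2 / 2 ^ k := by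
    have hterm : ∀ a, (MT a) ^ 2 ≤ (2 * Kp * H * e / 2 ^ k) ^ 2 := fun a => by
      rw [← sq_abs]
      exact pow_le_pow_left₀ (abs_nonneg _) (hMTa a) 2
    calc ∑ m ∈ Ico X (2 * X), ∑ a ∈ Todd, (MT a) ^ 2
        ≤ ∑ _m ∈ Ico X (2 * X), ∑ _a ∈ Todd, (2 * Kp * H * e / 2 ^ k) ^ 2 :=
          Finset.sum_le_sum fun m _ => Finset.sum_le_sum fun a _ => hterm a
      _ = (X : ℝ) * Todd.card * (2 * Kp * H * e / 2 ^ k) ^ 2 := by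
          rw [Finset.sum_const, Finset.sum_const, Nat.card_Ico, nsmul_eq_mul, nsmul_eq_mul,
            show (2 * X - X : ℕ) = X by omega]
          ring
      _ ≤ (X : ℝ) * 2 ^ k * (2 * Kp * H * e / 2 ^ k) ^ 2 := by gcongr
      _ = 4 * Kp ^ 2 * X * (H : ℝ) ^ 2 * e ^ 2 / 2 ^ k := by field_simp; ring
  -- (3) Cauchy–Schwarz
  have hCS := stub_kmt_cauchySchwarz (Ico X (2 * X)) Todd W (fun _ a => MT a)
  have hScard : (((Ico X (2 * X)).card : ℕ) : ℝ) = (X : ℝ) := by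
    rw [Nat.card_Ico, show (2 * X - X : ℕ) = X by omega]
  rw [hScard] at hCS
  have hS : ∑ m ∈ Ico X (2 * X), ∑ a ∈ Todd, |W m a| ≤
      (X : ℝ) * H * (Real.sqrt C₀ * Real.sqrt ε₁ + 3 * Kp * e) := by
    refine cs_numeric (MS := ∑ m ∈ Ico X (2 * X), ∑ a ∈ Todd, (W m a - MT a) ^ 2)
      (S := ∑ m ∈ Ico X (2 * X), ∑ a ∈ Todd, |W m a|) hXRpos hHRpos hqRpos hC₀.le hε₁.le hKp0 he0 ?_ hMT2 ?_
    · calc ∑ m ∈ Ico X (2 * X), ∑ a ∈ Todd, (W m a - MT a) ^ 2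
          ≤ C₀ * ε₁ * (Nat.totient (2 ^ k) : ℝ) * X * ((H : ℝ) / 2 ^ k) ^ 2 := hMS
        _ = C₀ * ε₁ * X * (H : ℝ) ^ 2 / (2 * 2 ^ k) := by rw [hφ]; field_simp
    · calc ∑ m ∈ Ico X (2 * X), ∑ a ∈ Todd, |W m a|
          ≤ Real.sqrt ((X : ℝ) * Todd.card) *
              Real.sqrt (2 * ∑ m ∈ Ico X (2 * X), ∑ a ∈ Todd, (W m a - MT a) ^ 2 +
                2 * ∑ m ∈ Ico X (2 * X), ∑ a ∈ Todd, (MT a) ^ 2) := hCS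
        _ ≤ Real.sqrt ((X : ℝ) * 2 ^ k) *
              Real.sqrt (2 * ∑ m ∈ Ico X (2 * X), ∑ a ∈ Todd, (W m a - MT a) ^ 2 +
                2 * ∑ m ∈ Ico X (2 * X), ∑ a ∈ Todd, (MT a) ^ 2) := by
            gcongr
  -- (4) window averaging, block by block
  have hblock : ∀ y a, |∑ N ∈ (Ico (H * y) (H * y + H)).filter (fun N => N % 2 ^ k = a),
      ((ArithmeticFunction.liouville N : ℤ) : ℝ)| ≤
      (1 / (T : ℝ)) * ∑ m ∈ Ico (H * y) (H * y + T), |W m a| + 2 * ((T : ℝ) / 2 ^ k + 1) := by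
    intro y a
    have := stub_kmt_window_average_AP (fun n => (ArithmeticFunction.liouville n : ℝ))
      Literature.NumberTheory.Sieve.abs_liouville_le_one
      (2 ^ k) a (H * y) H T hTpos hTH
    simp_rw [← hWdef] at this
    rw [hqR] at this
    convert this using 4
  -- (5) assembly
  have hwin_sum : ∑ y ∈ Ico (2 ^ (i - h)) (2 ^ (i + 1 - h)), ∑ a ∈ Todd, ∑ m ∈ Ico (H * y) (H * y + T), |W m a|
      ≤ ∑ m ∈ Ico X (2 * X), ∑ a ∈ Todd, |W m a| := by
    calc ∑ y ∈ Ico (2 ^ (i - h)) (2 ^ (i + 1 - h)), ∑ a ∈ Todd, ∑ m ∈ Ico (H * y) (H * y + T), |W m a|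
        = ∑ y ∈ Ico (2 ^ (i - h)) (2 ^ (i + 1 - h)), ∑ m ∈ Ico (H * y) (H * y + T), ∑ a ∈ Todd, |W m a| := by
          refine Finset.sum_congr rfl fun y _ => Finset.sum_comm
      _ ≤ ∑ m ∈ Ico X (2 * X), ∑ a ∈ Todd, |W m a| := by
          refine sum_windows_le (fun m => ∑ a ∈ Todd, |W m a|)
            (fun m => Finset.sum_nonneg fun a _ => abs_nonneg _) H T _ _ X hTH ?_ ?_
          · rw [hHdef, hXdef, ← pow_add]
            exact Nat.pow_le_pow_right (by norm_num) (by omega)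
          · rw [hHdef, hXdef, ← pow_add, ← pow_succ']
            exact Nat.pow_le_pow_right (by norm_num) (by omega)
  have hYcard : (((Ico (2 ^ (i - h)) (2 ^ (i + 1 - h))).card : ℕ) : ℝ) = (2 : ℝ) ^ i / 2 ^ h := by
    rw [Nat.card_Ico, show i + 1 - h = (i - h) + 1 by omega, pow_succ,
      show 2 ^ (i - h) * 2 - 2 ^ (i - h) = 2 ^ (i - h) by omega]
    push_cast
    rw [eq_div_iff (by positivity), ← pow_add, Nat.sub_add_cancel hhi]
  rw [← hTodd]
  calc ∑ y ∈ Ico (2 ^ (i - h)) (2 ^ (i + 1 - h)), ∑ a ∈ Todd,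
        |∑ N ∈ (Ico (H * y) (H * y + H)).filter (fun N => N % 2 ^ k = a),
          ((ArithmeticFunction.liouville N : ℤ) : ℝ)|
      ≤ ∑ y ∈ Ico (2 ^ (i - h)) (2 ^ (i + 1 - h)), ∑ a ∈ Todd,
          ((1 / (T : ℝ)) * ∑ m ∈ Ico (H * y) (H * y + T), |W m a| + 2 * ((T : ℝ) / 2 ^ k + 1)) :=
        Finset.sum_le_sum fun y _ => Finset.sum_le_sum fun a _ => hblock y a
    _ = (1 / (T : ℝ)) * ∑ y ∈ Ico (2 ^ (i - h)) (2 ^ (i + 1 - h)), ∑ a ∈ Todd,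
          ∑ m ∈ Ico (H * y) (H * y + T), |W m a| +
        ((Ico (2 ^ (i - h)) (2 ^ (i + 1 - h))).card : ℝ) * Todd.card * (2 * ((T : ℝ) / 2 ^ k + 1)) := by
        rw [Finset.mul_sum]
        simp_rw [Finset.sum_add_distrib, Finset.mul_sum, Finset.sum_const, nsmul_eq_mul]
        ring
    _ ≤ (1 / (T : ℝ)) * ((X : ℝ) * H * (Real.sqrt C₀ * Real.sqrt ε₁ + 3 * Kp * e)) +
        ((2 : ℝ) ^ i / 2 ^ h) * 2 ^ k * (2 * ((T : ℝ) / 2 ^ k + 1)) := by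
        rw [hYcard]
        gcongr
        · exact hwin_sum.trans hS
    _ = (2 : ℝ) ^ i * (2 ^ τ * (Real.sqrt C₀ * Real.sqrt ε₁ + 3 * Kp *
          Real.exp (-(c₂ * Real.sqrt (i * Real.log 2)))) + 2 / 2 ^ τ + 2 * 2 ^ k / 2 ^ h) := by
        rw [← heX, hTR, hXR, hHR]
        field_simp
        ring

end Summit.QuantumAdvantage.DigitPolyUniformity.SketchLAR.KMT

end
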